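import Summits.Ventures.DiscreteObjects.Hadamard.CompositeOrderStructure668B

/-!
# Hadamard 668 census, family F12 — structure of (hypothetical) automorphisms of order 55 and 69 of an H(668)
# (kernel; counting + the free-orbit bound; lead item H14-5)

Framing: lottery ticket; floor = certified bounds/negative ranges.

Cell pub-namedobj (venture DiscreteObjects), target (H), hadamard gen 18.  Continuation of `CompositeOrderStructure668(B)`
(gen 17: orders 143, 91, 111, 123, 65, 77) for the two remaining products with a SHORT case list.  For a signed
automorphism `(π, κ, d, e)` of an H(668) with `π^(pq) = κ^(pq) = 1` and both parts nontrivial, `counting_cols`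
(`#Fix(κ^p) = p·a + f'`, `#Fix(κ^q) = q·b + f'`, `f' = #(Fix κ^q ∩ Fix κ^p)`), the censuses (`census3`, `census5`,
`census11`, `hadamard668_signedAut_fixedRows` for `23`) and the free-orbit bound `composite_fixed_bound` (`pq·f' ≤ 668`)
leave (columns; rows alike):
* **order 55 = 5·11** (`hadamard668_order55_structure`): `(f₅, f₁₁, f') ∈ {(8,8,8), (18,52,7), (38,30,5), (58,8,3),
  (68,52,2), (78,52,12), (88,30,0), (98,30,10)}` (`f₅ = #Fix` of the `5`-part `κ^11`, `f₁₁ = #Fix` of the `11`-part `κ^5`);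
* **order 69 = 3·23** (`hadamard668_order69_structure`): `(f₃, f₂₃, f') ∈ {(26,24,3), (32,24,9), (92,24,0), (98,24,6),
  (116,1,1), (164,24,3)}`.
The remaining 'open by counting' products 15, 21, 33, 35, 39 have 687 / 189 / 41 / 31 / 14 admissible triples by the
same recipe (exact enumeration `pub-namedobj-hadamard-g18/code/composite_windows_g18.py`, which reproduces the six
gen-17 kernel case lists exactly) — too many for a useful kernel disjunction; recorded as data.  No order is excluded.
Ours, not literature; no `sorry`.
-/

namespace Summit.Ventures.DiscreteObjects.Hadamard

open Finset BigOperators Matrix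

open Literature.Combinatorics.Designs.GoethalsSeidel (IsHadamardMatrix)

variable {ι : Type*} [Fintype ι] [DecidableEq ι]

section compositeC
variable {H : Matrix ι ι ℤ}

/-- columns, order 55: the eight admissible triples `(f₅, f₁₁, f')` -/
lemma order55_cols (hH : IsHadamardMatrix H) (hι : Fintype.card ι = 668)
    {π κ : Equiv.Perm ι} {d e : ι → ℤ} (haut : IsSignedAut H π κ d e)
    (hπ : π ^ (5 * 11) = 1) (hκ : κ ^ (5 * 11) = 1) (h11 : π ^ 11 ≠ 1 ∨ κ ^ 11 ≠ 1) (h5 : π ^ 5 ≠ 1 ∨ κ ^ 5 ≠ 1) :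
    ((univ.filter fun j => (κ ^ 11) j = j).card = 8 ∧ (univ.filter fun j => (κ ^ 5) j = j).card = 8 ∧
        (univ.filter fun j => (κ ^ 11) j = j ∧ (κ ^ 5) j = j).card = 8) ∨
    ((univ.filter fun j => (κ ^ 11) j = j).card = 18 ∧ (univ.filter fun j => (κ ^ 5) j = j).card = 52 ∧
        (univ.filter fun j => (κ ^ 11) j = j ∧ (κ ^ 5) j = j).card = 7) ∨
    ((univ.filter fun j => (κ ^ 11) j = j).card = 38 ∧ (univ.filter fun j => (κ ^ 5) j = j).card = 30 ∧
        (univ.filter fun j => (κ ^ 11) j = j ∧ (κ ^ 5) j = j).card = 5) ∨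
    ((univ.filter fun j => (κ ^ 11) j = j).card = 58 ∧ (univ.filter fun j => (κ ^ 5) j = j).card = 8 ∧
        (univ.filter fun j => (κ ^ 11) j = j ∧ (κ ^ 5) j = j).card = 3) ∨
    ((univ.filter fun j => (κ ^ 11) j = j).card = 68 ∧ (univ.filter fun j => (κ ^ 5) j = j).card = 52 ∧
        (univ.filter fun j => (κ ^ 11) j = j ∧ (κ ^ 5) j = j).card = 2) ∨
    ((univ.filter fun j => (κ ^ 11) j = j).card = 78 ∧ (univ.filter fun j => (κ ^ 5) j = j).card = 52 ∧
        (univ.filter fun j => (κ ^ 11) j = j ∧ (κ ^ 5) j = j).card = 12) ∨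
    ((univ.filter fun j => (κ ^ 11) j = j).card = 88 ∧ (univ.filter fun j => (κ ^ 5) j = j).card = 30 ∧
        (univ.filter fun j => (κ ^ 11) j = j ∧ (κ ^ 5) j = j).card = 0) ∨
    ((univ.filter fun j => (κ ^ 11) j = j).card = 98 ∧ (univ.filter fun j => (κ ^ 5) j = j).card = 30 ∧
        (univ.filter fun j => (κ ^ 11) j = j ∧ (κ ^ 5) j = j).card = 10) := by
  have hcard : (Fintype.card ι : ℤ) ≠ 0 := by rw [hι]; norm_num
  have hπ11 : (π ^ 11) ^ 5 = 1 := by rw [← pow_mul]; exact hπ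
  have hκ11 : (κ ^ 11) ^ 5 = 1 := by rw [← pow_mul]; exact hκ
  have hπ5 : (π ^ 5) ^ 11 = 1 := by rw [← pow_mul]; exact hπ
  have hκ5 : (κ ^ 5) ^ 11 = 1 := by rw [← pow_mul]; exact hκ
  have hne11 : π ^ 11 ≠ 1 := fst_pow_ne_one hH hcard haut (by decide : Odd 5) hκ11 h11
  have hne5 : π ^ 5 ≠ 1 := fst_pow_ne_one hH hcard haut (by decide : Odd 11) hκ5 h5
  obtain ⟨⟨c5C1, c5C2, c5Cm⟩, ⟨c5R1, c5R2, c5Rm⟩⟩ := census5 hH hι (isSignedAut_pow haut 11) hπ11 hκ11 hne11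
  obtain ⟨c11C, c11R⟩ := census11 hH hι (isSignedAut_pow haut 5) hπ5 hκ5 hne5
  obtain ⟨c1, ⟨a, ha⟩, c2, ⟨b, hb⟩, -, -⟩ :=
    counting_cols κ (by norm_num : (5 : ℕ).Prime) (by norm_num : (11 : ℕ).Prime) hκ
  have hbd := composite_fixed_bound hH hι haut (by norm_num : (5 : ℕ).Prime) (by norm_num : (11 : ℕ).Prime)
    (by norm_num) (by decide : Odd (5 * 11)) hπ hκ (by rcases c11R with h' | h' | h' <;> omega)
  -- scalarise: F₅ = #Fix(κ^11), F₁₁ = #Fix(κ^5), f' = #(both), then pure arithmetic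
  clear c11R c5R1 c5R2 c5Rm
  obtain ⟨f', hf'def⟩ : ∃ f' : ℕ, f' = (univ.filter fun j => (κ ^ 11) j = j ∧ (κ ^ 5) j = j).card := ⟨_, rfl⟩
  obtain ⟨F₅, hF₅⟩ : ∃ F : ℕ, F = (univ.filter fun j => (κ ^ 11) j = j).card := ⟨_, rfl⟩
  obtain ⟨F₁₁, hF₁₁⟩ : ∃ F : ℕ, F = (univ.filter fun j => (κ ^ 5) j = j).card := ⟨_, rfl⟩
  rw [← hf'def] at c1 c2 hbd
  rw [← hF₅] at c2 c5C1 c5C2 c5Cm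
  rw [← hF₁₁] at c1 c11C
  rw [← hf'def, ← hF₅, ← hF₁₁]
  have e1 : F₁₁ = 5 * a + f' := by rw [c1, ha]
  have e2 : F₅ = 11 * b + f' := by rw [c2, hb]
  clear c1 c2 ha hb hf'def hF₅ hF₁₁
  have hbd' : 55 * f' ≤ 668 := by simpa using hbd
  clear hbd
  rcases c11C with h' | h' | h' <;> subst h'
  · have hf : f' = 3 ∨ f' = 8 := by omega
    rcases hf with rfl | rfl
    · have h5v : F₅ = 58 := by omega
      subst h5v; decide
    · have h5v : F₅ = 8 := by omega
      subst h5v; decide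
  · have hf : f' = 0 ∨ f' = 5 ∨ f' = 10 := by omega
    rcases hf with rfl | rfl | rfl
    · have h5v : F₅ = 88 := by omega
      subst h5v; decide
    · have h5v : F₅ = 38 := by omega
      subst h5v; decide
    · have h5v : F₅ = 98 := by omega
      subst h5v; decide
  · have hf : f' = 2 ∨ f' = 7 ∨ f' = 12 := by omega
    rcases hf with rfl | rfl | rfl
    · have h5v : F₅ = 68 := by omega
      subst h5v; decide
    · have h5v : F₅ = 18 := by omega
      subst h5v; decide
    · have h5v : F₅ = 78 := by omega
      subst h5v; decide

/-- **order 55 = 5·11**: `(#Fix of the 5-part, #Fix of the 11-part, #(both))` lies in the eight-element list of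
`order55_cols`, on columns and on rows.  Structure only. -/
theorem hadamard668_order55_structure (hH : IsHadamardMatrix H) (hι : Fintype.card ι = 668)
    (π κ : Equiv.Perm ι) (d e : ι → ℤ) (haut : IsSignedAut H π κ d e)
    (hπ : π ^ (5 * 11) = 1) (hκ : κ ^ (5 * 11) = 1) (h11 : π ^ 11 ≠ 1 ∨ κ ^ 11 ≠ 1) (h5 : π ^ 5 ≠ 1 ∨ κ ^ 5 ≠ 1) :
    (((univ.filter fun j => (κ ^ 11) j = j).card = 8 ∧ (univ.filter fun j => (κ ^ 5) j = j).card = 8 ∧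
        (univ.filter fun j => (κ ^ 11) j = j ∧ (κ ^ 5) j = j).card = 8) ∨
     ((univ.filter fun j => (κ ^ 11) j = j).card = 18 ∧ (univ.filter fun j => (κ ^ 5) j = j).card = 52 ∧
        (univ.filter fun j => (κ ^ 11) j = j ∧ (κ ^ 5) j = j).card = 7) ∨
     ((univ.filter fun j => (κ ^ 11) j = j).card = 38 ∧ (univ.filter fun j => (κ ^ 5) j = j).card = 30 ∧
        (univ.filter fun j => (κ ^ 11) j = j ∧ (κ ^ 5) j = j).card = 5) ∨
     ((univ.filter fun j => (κ ^ 11) j = j).card = 58 ∧ (univ.filter fun j => (κ ^ 5) j = j).card = 8 ∧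
        (univ.filter fun j => (κ ^ 11) j = j ∧ (κ ^ 5) j = j).card = 3) ∨
     ((univ.filter fun j => (κ ^ 11) j = j).card = 68 ∧ (univ.filter fun j => (κ ^ 5) j = j).card = 52 ∧
        (univ.filter fun j => (κ ^ 11) j = j ∧ (κ ^ 5) j = j).card = 2) ∨
     ((univ.filter fun j => (κ ^ 11) j = j).card = 78 ∧ (univ.filter fun j => (κ ^ 5) j = j).card = 52 ∧
        (univ.filter fun j => (κ ^ 11) j = j ∧ (κ ^ 5) j = j).card = 12) ∨
     ((univ.filter fun j => (κ ^ 11) j = j).card = 88 ∧ (univ.filter fun j => (κ ^ 5) j = j).card = 30 ∧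
        (univ.filter fun j => (κ ^ 11) j = j ∧ (κ ^ 5) j = j).card = 0) ∨
     ((univ.filter fun j => (κ ^ 11) j = j).card = 98 ∧ (univ.filter fun j => (κ ^ 5) j = j).card = 30 ∧
        (univ.filter fun j => (κ ^ 11) j = j ∧ (κ ^ 5) j = j).card = 10)) ∧
    (((univ.filter fun i => (π ^ 11) i = i).card = 8 ∧ (univ.filter fun i => (π ^ 5) i = i).card = 8 ∧
        (univ.filter fun i => (π ^ 11) i = i ∧ (π ^ 5) i = i).card = 8) ∨
     ((univ.filter fun i => (π ^ 11) i = i).card = 18 ∧ (univ.filter fun i => (π ^ 5) i = i).card = 52 ∧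
        (univ.filter fun i => (π ^ 11) i = i ∧ (π ^ 5) i = i).card = 7) ∨
     ((univ.filter fun i => (π ^ 11) i = i).card = 38 ∧ (univ.filter fun i => (π ^ 5) i = i).card = 30 ∧
        (univ.filter fun i => (π ^ 11) i = i ∧ (π ^ 5) i = i).card = 5) ∨
     ((univ.filter fun i => (π ^ 11) i = i).card = 58 ∧ (univ.filter fun i => (π ^ 5) i = i).card = 8 ∧
        (univ.filter fun i => (π ^ 11) i = i ∧ (π ^ 5) i = i).card = 3) ∨
     ((univ.filter fun i => (π ^ 11) i = i).card = 68 ∧ (univ.filter fun i => (π ^ 5) i = i).card = 52 ∧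
        (univ.filter fun i => (π ^ 11) i = i ∧ (π ^ 5) i = i).card = 2) ∨
     ((univ.filter fun i => (π ^ 11) i = i).card = 78 ∧ (univ.filter fun i => (π ^ 5) i = i).card = 52 ∧
        (univ.filter fun i => (π ^ 11) i = i ∧ (π ^ 5) i = i).card = 12) ∨
     ((univ.filter fun i => (π ^ 11) i = i).card = 88 ∧ (univ.filter fun i => (π ^ 5) i = i).card = 30 ∧
        (univ.filter fun i => (π ^ 11) i = i ∧ (π ^ 5) i = i).card = 0) ∨
     ((univ.filter fun i => (π ^ 11) i = i).card = 98 ∧ (univ.filter fun i => (π ^ 5) i = i).card = 30 ∧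
        (univ.filter fun i => (π ^ 11) i = i ∧ (π ^ 5) i = i).card = 10)) := by
  have hcard : (Fintype.card ι : ℤ) ≠ 0 := by rw [hι]; norm_num
  exact ⟨order55_cols hH hι haut hπ hκ h11 h5,
    order55_cols (isHadamard_transpose hH hcard) hι (isSignedAut_transpose haut) hκ hπ h11.symm h5.symm⟩

/-- columns, order 69: the six admissible triples `(f₃, f₂₃, f')` -/
lemma order69_cols (hH : IsHadamardMatrix H) (hι : Fintype.card ι = 668)
    {π κ : Equiv.Perm ι} {d e : ι → ℤ} (haut : IsSignedAut H π κ d e)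
    (hπ : π ^ (3 * 23) = 1) (hκ : κ ^ (3 * 23) = 1) (h23 : π ^ 23 ≠ 1 ∨ κ ^ 23 ≠ 1) (h3 : π ^ 3 ≠ 1 ∨ κ ^ 3 ≠ 1) :
    ((univ.filter fun j => (κ ^ 23) j = j).card = 26 ∧ (univ.filter fun j => (κ ^ 3) j = j).card = 24 ∧
        (univ.filter fun j => (κ ^ 23) j = j ∧ (κ ^ 3) j = j).card = 3) ∨
    ((univ.filter fun j => (κ ^ 23) j = j).card = 32 ∧ (univ.filter fun j => (κ ^ 3) j = j).card = 24 ∧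
        (univ.filter fun j => (κ ^ 23) j = j ∧ (κ ^ 3) j = j).card = 9) ∨
    ((univ.filter fun j => (κ ^ 23) j = j).card = 92 ∧ (univ.filter fun j => (κ ^ 3) j = j).card = 24 ∧
        (univ.filter fun j => (κ ^ 23) j = j ∧ (κ ^ 3) j = j).card = 0) ∨
    ((univ.filter fun j => (κ ^ 23) j = j).card = 98 ∧ (univ.filter fun j => (κ ^ 3) j = j).card = 24 ∧
        (univ.filter fun j => (κ ^ 23) j = j ∧ (κ ^ 3) j = j).card = 6) ∨
    ((univ.filter fun j => (κ ^ 23) j = j).card = 116 ∧ (univ.filter fun j => (κ ^ 3) j = j).card = 1 ∧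
        (univ.filter fun j => (κ ^ 23) j = j ∧ (κ ^ 3) j = j).card = 1) ∨
    ((univ.filter fun j => (κ ^ 23) j = j).card = 164 ∧ (univ.filter fun j => (κ ^ 3) j = j).card = 24 ∧
        (univ.filter fun j => (κ ^ 23) j = j ∧ (κ ^ 3) j = j).card = 3) := by
  have hcard : (Fintype.card ι : ℤ) ≠ 0 := by rw [hι]; norm_num
  have hπ23 : (π ^ 23) ^ 3 = 1 := by rw [← pow_mul]; exact hπ
  have hκ23 : (κ ^ 23) ^ 3 = 1 := by rw [← pow_mul]; exact hκ
  have hπ3 : (π ^ 3) ^ 23 = 1 := by rw [← pow_mul]; exact hπ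
  have hκ3 : (κ ^ 3) ^ 23 = 1 := by rw [← pow_mul]; exact hκ
  have hne23 : π ^ 23 ≠ 1 := fst_pow_ne_one hH hcard haut (by decide : Odd 3) hκ23 h23
  obtain ⟨⟨c3C1, c3C2, c3Cm⟩, ⟨c3R1, c3R2, c3Rm⟩⟩ := census3 hH hι (isSignedAut_pow haut 23) hπ23 hκ23 hne23
  obtain ⟨eRC, h24⟩ := hadamard668_signedAut_fixedRows hH hι 23 (by norm_num) (by norm_num) (π ^ 3) (κ ^ 3) _ _
    (isSignedAut_pow haut 3) hπ3 hκ3 h3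
  have h24R : (univ.filter fun i => (π ^ 3) i = i).card = 1 ∨ (univ.filter fun i => (π ^ 3) i = i).card = 24 := by
    rcases h24 with ⟨h, -⟩ | ⟨-, h⟩ | ⟨h, -⟩ | ⟨h, -⟩ | ⟨h, -⟩ | ⟨h, -⟩ <;> first | exact h | norm_num at h
  have h24C : (univ.filter fun j => (κ ^ 3) j = j).card = 1 ∨ (univ.filter fun j => (κ ^ 3) j = j).card = 24 := by
    rw [← eRC]; exact h24R
  obtain ⟨c1, ⟨a, ha⟩, c2, ⟨b, hb⟩, -, -⟩ :=
    counting_cols κ (by norm_num : (3 : ℕ).Prime) (by norm_num : (23 : ℕ).Prime) hκ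
  have hbd := composite_fixed_bound hH hι haut (by norm_num : (3 : ℕ).Prime) (by norm_num : (23 : ℕ).Prime)
    (by norm_num) (by decide : Odd (3 * 23)) hπ hκ (by rcases h24R with h' | h' <;> omega)
  -- scalarise: F₃ = #Fix(κ^23), F₂₃ = #Fix(κ^3), f' = #(both), then pure arithmetic
  clear h24 h24R c3R1 c3R2 c3Rm eRC hne23 hπ23 hκ23 hπ3 hκ3
  obtain ⟨f', hf'def⟩ : ∃ f' : ℕ, f' = (univ.filter fun j => (κ ^ 23) j = j ∧ (κ ^ 3) j = j).card := ⟨_, rfl⟩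
  obtain ⟨F₃, hF₃⟩ : ∃ F : ℕ, F = (univ.filter fun j => (κ ^ 23) j = j).card := ⟨_, rfl⟩
  obtain ⟨F₂₃, hF₂₃⟩ : ∃ F : ℕ, F = (univ.filter fun j => (κ ^ 3) j = j).card := ⟨_, rfl⟩
  rw [← hf'def] at c1 c2 hbd
  rw [← hF₃] at c2 c3C1 c3C2 c3Cm
  rw [← hF₂₃] at c1 h24C
  rw [← hf'def, ← hF₃, ← hF₂₃]
  have e1 : F₂₃ = 3 * a + f' := by rw [c1, ha]
  have e2 : F₃ = 23 * b + f' := by rw [c2, hb]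
  clear c1 c2 ha hb hf'def hF₃ hF₂₃
  have hbd' : 69 * f' ≤ 668 := by simpa using hbd
  clear hbd
  rcases h24C with h' | h'
  · subst h'
    have hf : f' = 1 := by omega
    subst hf
    have h3v : F₃ = 116 := by omega
    subst h3v; decide
  · subst h'
    have hf9 : f' ≤ 9 := by omega
    obtain ⟨k, hk⟩ : ∃ k : ℕ, F₃ = 6 * k + 2 := ⟨F₃ / 6, by omega⟩
    clear c3Cm hbd'
    interval_cases f'
    all_goals first
      | (exfalso; omega)
      | (have h3v : F₃ = 92 := by omega
         subst h3v; decide)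
      | (have h3v : F₃ = 98 := by omega
         subst h3v; decide)
      | (have h3v : F₃ = 32 := by omega
         subst h3v; decide)
      | (have h3v : F₃ = 26 ∨ F₃ = 164 := by omega
         rcases h3v with rfl | rfl <;> decide)

/-- **order 69 = 3·23**: `(#Fix of the 3-part, #Fix of the 23-part, #(both))` lies in the six-element list of
`order69_cols`, on columns and on rows.  Structure only. -/
theorem hadamard668_order69_structure (hH : IsHadamardMatrix H) (hι : Fintype.card ι = 668)
    (π κ : Equiv.Perm ι) (d e : ι → ℤ) (haut : IsSignedAut H π κ d e)
    (hπ : π ^ (3 * 23) = 1) (hκ : κ ^ (3 * 23) = 1) (h23 : π ^ 23 ≠ 1 ∨ κ ^ 23 ≠ 1) (h3 : π ^ 3 ≠ 1 ∨ κ ^ 3 ≠ 1) :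
    (((univ.filter fun j => (κ ^ 23) j = j).card = 26 ∧ (univ.filter fun j => (κ ^ 3) j = j).card = 24 ∧
        (univ.filter fun j => (κ ^ 23) j = j ∧ (κ ^ 3) j = j).card = 3) ∨
     ((univ.filter fun j => (κ ^ 23) j = j).card = 32 ∧ (univ.filter fun j => (κ ^ 3) j = j).card = 24 ∧
        (univ.filter fun j => (κ ^ 23) j = j ∧ (κ ^ 3) j = j).card = 9) ∨
     ((univ.filter fun j => (κ ^ 23) j = j).card = 92 ∧ (univ.filter fun j => (κ ^ 3) j = j).card = 24 ∧
        (univ.filter fun j => (κ ^ 23) j = j ∧ (κ ^ 3) j = j).card = 0) ∨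
     ((univ.filter fun j => (κ ^ 23) j = j).card = 98 ∧ (univ.filter fun j => (κ ^ 3) j = j).card = 24 ∧
        (univ.filter fun j => (κ ^ 23) j = j ∧ (κ ^ 3) j = j).card = 6) ∨
     ((univ.filter fun j => (κ ^ 23) j = j).card = 116 ∧ (univ.filter fun j => (κ ^ 3) j = j).card = 1 ∧
        (univ.filter fun j => (κ ^ 23) j = j ∧ (κ ^ 3) j = j).card = 1) ∨
     ((univ.filter fun j => (κ ^ 23) j = j).card = 164 ∧ (univ.filter fun j => (κ ^ 3) j = j).card = 24 ∧
        (univ.filter fun j => (κ ^ 23) j = j ∧ (κ ^ 3) j = j).card = 3)) ∧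
    (((univ.filter fun i => (π ^ 23) i = i).card = 26 ∧ (univ.filter fun i => (π ^ 3) i = i).card = 24 ∧
        (univ.filter fun i => (π ^ 23) i = i ∧ (π ^ 3) i = i).card = 3) ∨
     ((univ.filter fun i => (π ^ 23) i = i).card = 32 ∧ (univ.filter fun i => (π ^ 3) i = i).card = 24 ∧
        (univ.filter fun i => (π ^ 23) i = i ∧ (π ^ 3) i = i).card = 9) ∨
     ((univ.filter fun i => (π ^ 23) i = i).card = 92 ∧ (univ.filter fun i => (π ^ 3) i = i).card = 24 ∧
        (univ.filter fun i => (π ^ 23) i = i ∧ (π ^ 3) i = i).card = 0) ∨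
     ((univ.filter fun i => (π ^ 23) i = i).card = 98 ∧ (univ.filter fun i => (π ^ 3) i = i).card = 24 ∧
        (univ.filter fun i => (π ^ 23) i = i ∧ (π ^ 3) i = i).card = 6) ∨
     ((univ.filter fun i => (π ^ 23) i = i).card = 116 ∧ (univ.filter fun i => (π ^ 3) i = i).card = 1 ∧
        (univ.filter fun i => (π ^ 23) i = i ∧ (π ^ 3) i = i).card = 1) ∨
     ((univ.filter fun i => (π ^ 23) i = i).card = 164 ∧ (univ.filter fun i => (π ^ 3) i = i).card = 24 ∧
        (univ.filter fun i => (π ^ 23) i = i ∧ (π ^ 3) i = i).card = 3)) := by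
  have hcard : (Fintype.card ι : ℤ) ≠ 0 := by rw [hι]; norm_num
  exact ⟨order69_cols hH hι haut hπ hκ h23 h3,
    order69_cols (isHadamard_transpose hH hcard) hι (isSignedAut_transpose haut) hκ hπ h23.symm h3.symm⟩

end compositeC

end Summit.Ventures.DiscreteObjects.Hadamard
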